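import Summits.QuantumFields.BalabanUV.Beta.CompositeCorrectorKernel
import Summits.QuantumFields.BalabanUV.Beta.CompositeCorrectorCovariance

/-!
# `BalabanUV.Beta.CompositeCorrectorKernelSpr` — binder row D1, work item K-U3d leaf L2 (PART 2): **BLOCK-TRANSLATION COVARIANCE AND SPREAD OF THE
# KERNELISED CORRECTORS** — `psiK_shift ∕ phiK_shift` (from the row-D1 owner's L1b `corrPsi_shift ∕ corrPhi_shift`), the uniform bound `abs_psiK_le`, and
# **`spr_psiK ∕ spr_phiK : Spr (psiK r L m) ∕ Spr (phiK r L m)`** (bounded + finite range `0` in block units ⟹ decay at every rate), the `Spr` inputs of K-U3d L4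
# (β sub-cell, BINDER-OWNERS row D1; cross-lane idle seat t4-ne9-formalise-leaf-06 gen 32 on the row-D1 OWNER an2-g24's leaf list `gen24/K-U3d-LEAVES.v1.md` §L2,
# owner GO R-D1-g24-3 journal l.24045 «PART 2 should IMPORT L1b `CompositeCorrectorCovariance` rather than re-prove»; over L2 `CompositeCorrectorKernel` BY NAME)

HONEST FRAMING (cell charter, verbatim): «discharging BetaPertH makes Balaban's UV stability UNCONDITIONAL — a real
constructive-QFT result; it is NOT the continuum limit and NOT the Clay problem.»
HONEST DEPENDENCY: continuum YM on T⁴ ⇐ BetaPertH ∧ nine spine estimates (0/9 proved); BetaPertH ⇐ (D1) ∧ (D4) ∧ CAP+tail;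
G-an2-4 gates asym, D1 and NE2/3/4.
ABSOLUTE RULE (cell, verbatim): «No internally-minted statement may enter as a cited fact. Every hypothesis is either kernel-proved in this
package or a verbatim quotation of a PUBLISHED theorem with page reference. The manuscript(s) under audit are NOT citable for their own
disputed steps — they are the thing under adjudication; programme-internal (2001/route/tribunal) claims are never citable.»
NOTHING below is cited: no `[cite: …]`, no `Prop` fact.  [our object] DATA (`colWindow`, `kerBound` — a finite window and an explicit sup bound) and [folklore]
bookkeeping over the cell's OWN typed objects BY NAME: lit's `ExpKernelCalculus.MKer ∕ Decays ∕ shiftK`, `B12Sec2to5.l1`, `HessKerSchurResolvent.idK`, the lead's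
`TameKernelCalculus.Spr`, an1's `AveragingContours.blk ∕ shift`, an2's `AxialProjector.blk_add_zsmul`, the row-D1 owner's L1b `CompositeCorrectorCovariance.corrPsi_shift ∕
corrPhi_shift` p243087, and this seat's L2 `CompositeCorrectorKernel` (`psiK ∕ phiK`, entries, `psiK_eq_idK_of_blk_ne ∕ phiK_eq_idK_of_blk_ne`) and
`CompositeCorrectorLocality` (`blockSitesF`, `le_of_blk ∕ lt_of_blk ∕ blk_apply_eq_of_bounds`).  It asserts nothing about Bałaban's non-linear averages.

WHY (K-U3d leaf L4 = the owner's socket `RelInvCompositeSocket.relInv_composite_of_corrector` fed with `Ψ := psiK r L m`, `Φ := phiK r L m`): the socket's congruence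
lemma `relInv_congr_kernel` needs ALL FIVE kernels `Spr`; this file supplies `Spr Ψ̂`, `Spr Φ̂`.  The argument is generic (§2): a kernel that is invariant under
simultaneous `n`-block translations and equals `idK` off the block window (L2's finite range `0`) takes finitely many values up to translation, hence is bounded, hence
decays at every rate with constant `kerBound · e^{δ·2(d+1)n}`.

WHAT (`d+1` the lattice dimension; `L ≥ 1` the block side, `m` levels, `n = L^m`; roots `r` in their blocks `hr`; all [folklore] unless marked):
§1 `shift_indR`, `kerOf_shift` (generic), **`psiK_shift ∕ phiK_shift`** (`Ψ̂_{(x + n v, ·),(y + n v, ·)} = Ψ̂_{(x,·),(y,·)}`), `shiftK_psiK ∕ shiftK_phiK` (both sign conventions).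
§2 GENERIC (`K` block-translation invariant with range `0` in block units): `blk_add_unitVec` (a unit step moves the block index by `0` or `e_α`), `l1_le_of_window`,
   [our object] `colWindow n`, `kerBound K n`; `one_le_kerBound`, `abs_le_kerBound_of_window`, **`abs_le_kerBound`**, **`decays_of_blockShift_of_range`**, `spr_of_blockShift_of_range`.
§3 **`abs_psiK_le ∕ abs_phiK_le`**, **`decays_psiK ∕ decays_phiK`** (every rate `δ ≥ 0`, constant `kerBound · exp (δ·2(d+1)n)`), **`spr_psiK ∕ spr_phiK`**, `spr_trK_psiK ∕ spr_trK_phiK`.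
Provenance: β sub-cell; cross-lane idle seat `b2b-balaban-t4-ne9-formalise-leaf-06` gen 32 (prover-b2b-balaban-t4-ne9-formalise-leaf-06-g32-0), 2026-08-21 (INTENT journal l.23693,
SHAPE l.23754, owner GO l.24045).  NOT (SDF), NOT D1, NEVER «(Z) closed» before L4 consumes `relInv_congr_kernel` BY NAME, NOT `BetaPertH`, NOT continuum, NOT Clay.
-/

namespace Summit.QuantumFields.BalabanUV.Beta.CompositeCorrectorKernel

open Finset
open scoped BigOperators
open Literature.MathematicalPhysics.QuantumFieldTheory.Balaban1983to89
open Literature.MathematicalPhysics.QuantumFieldTheory.Balaban1983to89.Beta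
open B12Sec2to5 (l1 l1_nonneg)
open ExpKernelCalculus (MKer Decays shiftK)
open HessKerSchurResolvent (idK idK_apply)
open OneStepResolventKernel (Fib)
open AffineAveraging (Site Form1 box unitVec unitVec_apply)
open AveragingContours (blk shift)
open AxialProjector (blk_add_zsmul)
open Summit.QuantumFields.BalabanUV.Beta.TameKernelCalculus (Spr trK)
open Summit.QuantumFields.BalabanUV.Beta.CompositeCorrectorForms (corrPhi corrPsi)
open Summit.QuantumFields.BalabanUV.Beta.CompositeCorrectorCovariance (corrPsi_shift corrPhi_shift)
open Summit.QuantumFields.BalabanUV.Beta.CompositeCorrectorLocality (blockSitesF mem_blockSitesF_of_blk_eq le_of_blk lt_of_blk blk_apply_eq_of_bounds)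

noncomputable section

variable {d : ℕ}

/-! ## §1 Block-translation covariance -/

/-- [folklore] The translate of the indicator of the translated bond is the indicator: `shift v (e_{(β, y + v)}) = e_{(β, y)}`. -/
theorem shift_indR (β : Fin (d + 1)) (y v : Site (d + 1)) : shift v (indR β (y + v)) = indR β y := by
  funext κ w
  simp only [shift, indR_apply, add_left_inj]

/-- [folklore] **COVARIANCE OF THE KERNELISER** (generic): if `T (shift v A) = shift v (T A)` for the translation `v`, then
`kerOf T (x + v) (y + v) = kerOf T x y`. -/
theorem kerOf_shift {T : Form1 (d + 1) ℝ → Form1 (d + 1) ℝ} {v : Site (d + 1)} (hT : ∀ A, T (shift v A) = shift v (T A))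
    (x y : Site (d + 1)) (a b : Fib d) : kerOf T (x + v) (y + v) a b = kerOf T x y a b := by
  rcases a with α | μ <;> rcases b with β | μ'
  · rw [kerOf_inl_inl, kerOf_inl_inl, ← shift_indR β y v, hT]
    rfl
  · rfl
  · rfl
  · simp only [kerOf_inr_inr, add_left_inj]

/-- [folklore] **BLOCK-TRANSLATION COVARIANCE OF `Ψ̂`**: `Ψ̂_{(x + n v, a),(y + n v, b)} = Ψ̂_{(x,a),(y,b)}`, `n = L^m`, `1 ≤ L` (the owner's L1b `corrPsi_shift`). -/
theorem psiK_shift {L : ℕ} (hL : 1 ≤ L) (r : ℕ → (Fin (d + 1) → ℕ)) (m : ℕ) (x y v : Site (d + 1)) (a b : Fib d) :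
    psiK r L m (x + (((L ^ m : ℕ) : ℤ)) • v) (y + (((L ^ m : ℕ) : ℤ)) • v) a b = psiK r L m x y a b :=
  kerOf_shift (fun A => corrPsi_shift hL r m A v) x y a b

/-- [folklore] **BLOCK-TRANSLATION COVARIANCE OF `Φ̂`** (the owner's L1b `corrPhi_shift`). -/
theorem phiK_shift {L : ℕ} (hL : 1 ≤ L) (r : ℕ → (Fin (d + 1) → ℕ)) (m : ℕ) (x y v : Site (d + 1)) (a b : Fib d) :
    phiK r L m (x + (((L ^ m : ℕ) : ℤ)) • v) (y + (((L ^ m : ℕ) : ℤ)) • v) a b = phiK r L m x y a b :=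
  kerOf_shift (fun A => corrPhi_shift hL r m A v) x y a b

/-- [folklore] `shiftK (n • v) Ψ̂ = Ψ̂`. -/
theorem shiftK_psiK {L : ℕ} (hL : 1 ≤ L) (r : ℕ → (Fin (d + 1) → ℕ)) (m : ℕ) (v : Site (d + 1)) :
    shiftK ((((L ^ m : ℕ) : ℤ)) • v) (psiK r L m) = psiK r L m := by
  funext x y a b
  exact psiK_shift hL r m x y v a b

/-- [folklore] `shiftK (−(n • t)) Ψ̂ = Ψ̂` (the sign convention of `AxialDressingRootedBmKernel.shiftK_coDressKBmAt`). -/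
theorem shiftK_neg_psiK {L : ℕ} (hL : 1 ≤ L) (r : ℕ → (Fin (d + 1) → ℕ)) (m : ℕ) (t : Site (d + 1)) :
    shiftK (-((((L ^ m : ℕ) : ℤ)) • t)) (psiK r L m) = psiK r L m := by
  rw [← smul_neg]
  exact shiftK_psiK hL r m (-t)

/-- [folklore] `shiftK (n • v) Φ̂ = Φ̂`. -/
theorem shiftK_phiK {L : ℕ} (hL : 1 ≤ L) (r : ℕ → (Fin (d + 1) → ℕ)) (m : ℕ) (v : Site (d + 1)) :
    shiftK ((((L ^ m : ℕ) : ℤ)) • v) (phiK r L m) = phiK r L m := by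
  funext x y a b
  exact phiK_shift hL r m x y v a b

/-- [folklore] `shiftK (−(n • t)) Φ̂ = Φ̂`. -/
theorem shiftK_neg_phiK {L : ℕ} (hL : 1 ≤ L) (r : ℕ → (Fin (d + 1) → ℕ)) (m : ℕ) (t : Site (d + 1)) :
    shiftK (-((((L ^ m : ℕ) : ℤ)) • t)) (phiK r L m) = phiK r L m := by
  rw [← smul_neg]
  exact shiftK_phiK hL r m (-t)

/-! ## §2 Generic: a block-translation invariant kernel with range `0` in block units is bounded and spread -/

/-- [folklore] A unit step moves the block index by `0` or by the unit step: `blk n (x + e_α) = blk n x` or `= blk n x + e_α` (`0 < n`). -/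
theorem blk_add_unitVec {n : ℕ} (hn : 0 < n) (x : Site (d + 1)) (α : Fin (d + 1)) :
    blk n (x + unitVec α) = blk n x ∨ blk n (x + unitVec α) = blk n x + unitVec α := by
  have h1 := le_of_blk hn x α
  have h2 := lt_of_blk hn x α
  have hoff : ∀ j, j ≠ α → blk n (x + unitVec α) j = blk n x j := fun j hj => by
    show (x + unitVec α) j / (n : ℤ) = x j / (n : ℤ)
    rw [Pi.add_apply, unitVec_apply, if_neg hj, add_zero]
  by_cases hc : x α + 1 < (n : ℤ) * blk n x α + n
  · left
    funext j
    by_cases hj : j = α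
    · subst hj
      refine blk_apply_eq_of_bounds hn ?_ ?_
      · rw [Pi.add_apply, unitVec_apply, if_pos rfl]; omega
      · rw [Pi.add_apply, unitVec_apply, if_pos rfl]; exact hc
    · exact hoff j hj
  · right
    funext j
    by_cases hj : j = α
    · subst hj
      rw [Pi.add_apply (blk n x), unitVec_apply, if_pos rfl]
      refine blk_apply_eq_of_bounds hn ?_ ?_
      · rw [Pi.add_apply, unitVec_apply, if_pos rfl, mul_add, mul_one]; omega
      · rw [Pi.add_apply, unitVec_apply, if_pos rfl, mul_add, mul_one]
        have : (0 : ℤ) < n := by exact_mod_cast hn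
        omega
    · rw [Pi.add_apply (blk n x), unitVec_apply, if_neg hj, add_zero]
      exact hoff j hj

/-- [our object] THE COLUMN WINDOW OF BLOCK `0`: the sites of the `n`-block `0` and of the `n`-blocks `e_α`. -/
def colWindow (n : ℕ) : Finset (Site (d + 1)) := blockSitesF n 0 ∪ Finset.univ.biUnion fun α : Fin (d + 1) => blockSitesF n (unitVec α)

/-- [folklore] A site whose block is `0` or some `e_α` is in the column window. -/
theorem mem_colWindow {n : ℕ} (hn : 0 < n) {y : Site (d + 1)} (h : blk n y = 0 ∨ ∃ α : Fin (d + 1), blk n y = unitVec α) :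
    y ∈ colWindow n := by
  rw [colWindow, Finset.mem_union]
  rcases h with h | ⟨α, h⟩
  · exact Or.inl (mem_blockSitesF_of_blk_eq hn h)
  · exact Or.inr (Finset.mem_biUnion.2 ⟨α, Finset.mem_univ _, mem_blockSitesF_of_blk_eq hn h⟩)

/-- [folklore] Two sites whose blocks are `0` or some `e_α` are `ℓ¹`-close: `l1 (x − y) ≤ 2(d+1)n`. -/
theorem l1_le_of_window {n : ℕ} (hn : 0 < n) {x y : Site (d + 1)} (hx : blk n x = 0)
    (hy : blk n y = 0 ∨ ∃ α : Fin (d + 1), blk n y = unitVec α) : l1 (x - y) ≤ 2 * (((d : ℝ) + 1) * n) := by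
  have hyb : ∀ j, (0 : ℤ) ≤ blk n y j ∧ blk n y j ≤ 1 := by
    intro j
    rcases hy with hy | ⟨α, hy⟩
    · rw [hy]; exact ⟨le_rfl, zero_le_one⟩
    · rw [hy, unitVec_apply]; split_ifs <;> simp
  have hj : ∀ j, |((x - y) j : ℝ)| ≤ 2 * (n : ℝ) := by
    intro j
    have hx1 := le_of_blk hn x j
    have hx2 := lt_of_blk hn x j
    rw [hx, Pi.zero_apply, mul_zero] at hx1 hx2
    have hy1 := le_of_blk hn y j
    have hy2 := lt_of_blk hn y j
    obtain ⟨hb0, hb1⟩ := hyb j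
    have hn' : (0 : ℤ) < n := by exact_mod_cast hn
    have hxy : |(x - y) j| ≤ 2 * (n : ℤ) := by
      rw [Pi.sub_apply, abs_le]
      constructor <;> nlinarith
    have h' : (((|(x - y) j| : ℤ) : ℝ)) ≤ ((2 * (n : ℤ) : ℤ) : ℝ) := Int.cast_le.2 hxy
    rw [Int.cast_abs] at h'
    push_cast at h'
    exact h'
  calc l1 (x - y) = ∑ j : Fin (d + 1), |((x - y) j : ℝ)| := rfl
    _ ≤ ∑ _j : Fin (d + 1), 2 * (n : ℝ) := Finset.sum_le_sum fun j _ => hj j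
    _ = 2 * (((d : ℝ) + 1) * n) := by
        rw [Finset.sum_const, Finset.card_univ, Fintype.card_fin, nsmul_eq_mul]; push_cast; ring

/-- [our object] THE EXPLICIT SUP BOUND of a kernel over the rows of block `0` and the columns of the window: `1 + Σ |K x y a b|`. -/
def kerBound (K : MKer (d + 1) (Fib d)) (n : ℕ) : ℝ :=
  1 + ∑ x ∈ blockSitesF n 0, ∑ y ∈ colWindow n, ∑ a : Fib d, ∑ b : Fib d, |K x y a b|

/-- [folklore] `1 ≤ kerBound`. -/
theorem one_le_kerBound (K : MKer (d + 1) (Fib d)) (n : ℕ) : 1 ≤ kerBound K n := by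
  unfold kerBound
  have : 0 ≤ ∑ x ∈ blockSitesF n 0, ∑ y ∈ colWindow (d := d) n, ∑ a : Fib d, ∑ b : Fib d, |K x y a b| :=
    Finset.sum_nonneg fun _ _ => Finset.sum_nonneg fun _ _ => Finset.sum_nonneg fun _ _ => Finset.sum_nonneg fun _ _ => abs_nonneg _
  linarith

/-- [folklore] An entry inside the window is bounded by `kerBound`. -/
theorem abs_le_kerBound_of_window (K : MKer (d + 1) (Fib d)) {n : ℕ} {x y : Site (d + 1)} (hx : x ∈ blockSitesF n 0) (hy : y ∈ colWindow n)
    (a b : Fib d) : |K x y a b| ≤ kerBound K n := by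
  unfold kerBound
  have h4 : |K x y a b| ≤ ∑ b' : Fib d, |K x y a b'| :=
    Finset.single_le_sum (f := fun b' => |K x y a b'|) (fun _ _ => abs_nonneg _) (Finset.mem_univ b)
  have h3 : ∑ b' : Fib d, |K x y a b'| ≤ ∑ a' : Fib d, ∑ b' : Fib d, |K x y a' b'| :=
    Finset.single_le_sum (f := fun a' => ∑ b' : Fib d, |K x y a' b'|) (fun _ _ => Finset.sum_nonneg fun _ _ => abs_nonneg _) (Finset.mem_univ a)
  have h2 : ∑ a' : Fib d, ∑ b' : Fib d, |K x y a' b'| ≤ ∑ y' ∈ colWindow n, ∑ a' : Fib d, ∑ b' : Fib d, |K x y' a' b'| :=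
    Finset.single_le_sum (f := fun y' => ∑ a' : Fib d, ∑ b' : Fib d, |K x y' a' b'|)
      (fun _ _ => Finset.sum_nonneg fun _ _ => Finset.sum_nonneg fun _ _ => abs_nonneg _) hy
  have h1 : ∑ y' ∈ colWindow n, ∑ a' : Fib d, ∑ b' : Fib d, |K x y' a' b'|
      ≤ ∑ x' ∈ blockSitesF n 0, ∑ y' ∈ colWindow n, ∑ a' : Fib d, ∑ b' : Fib d, |K x' y' a' b'| :=
    Finset.single_le_sum (f := fun x' => ∑ y' ∈ colWindow n, ∑ a' : Fib d, ∑ b' : Fib d, |K x' y' a' b'|)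
      (fun _ _ => Finset.sum_nonneg fun _ _ => Finset.sum_nonneg fun _ _ => Finset.sum_nonneg fun _ _ => abs_nonneg _) hx
  linarith

/-- [folklore] `|idK| ≤ 1`. -/
theorem abs_idK_le_one (x y : Site (d + 1)) (a b : Fib d) : |(idK : MKer (d + 1) (Fib d)) x y a b| ≤ 1 := by
  rw [idK_apply]
  split_ifs <;> simp

/-- [folklore] **UNIFORM BOUND** (generic): a kernel invariant under simultaneous `n`-block translations that equals `idK` off the block window is bounded by
`kerBound K n` everywhere. -/
theorem abs_le_kerBound {K : MKer (d + 1) (Fib d)} {n : ℕ} (hn : 0 < n)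
    (hshift : ∀ (x y v : Site (d + 1)) (a b : Fib d), K (x + (n : ℤ) • v) (y + (n : ℤ) • v) a b = K x y a b)
    (hrange : ∀ (x y : Site (d + 1)), blk n y ≠ blk n x → (∀ α : Fin (d + 1), blk n y ≠ blk n (x + unitVec α)) → ∀ a b, K x y a b = idK x y a b)
    (x y : Site (d + 1)) (a b : Fib d) : |K x y a b| ≤ kerBound K n := by
  have hn1 : 1 ≤ n := hn
  -- move the row into the block `0`
  set z := blk n x with hz
  have ex : x = (x + (n : ℤ) • (-z)) + (n : ℤ) • z := by rw [smul_neg]; abel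
  have ey : y = (y + (n : ℤ) • (-z)) + (n : ℤ) • z := by rw [smul_neg]; abel
  rw [ex, ey, hshift]
  have hx0 : blk n (x + (n : ℤ) • (-z)) = 0 := by rw [blk_add_zsmul hn1, hz, add_neg_cancel]
  by_cases hc : blk n (y + (n : ℤ) • (-z)) = blk n (x + (n : ℤ) • (-z)) ∨
      ∃ α : Fin (d + 1), blk n (y + (n : ℤ) • (-z)) = blk n (x + (n : ℤ) • (-z) + unitVec α)
  · refine abs_le_kerBound_of_window K (mem_blockSitesF_of_blk_eq hn hx0) (mem_colWindow hn ?_) a b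
    rcases hc with hc | ⟨α, hc⟩
    · exact Or.inl (hc.trans hx0)
    · rcases blk_add_unitVec hn (x + (n : ℤ) • (-z)) α with h | h
      · exact Or.inl (hc.trans (h.trans hx0))
      · exact Or.inr ⟨α, by rw [hc, h, hx0, zero_add]⟩
  · push Not at hc
    rw [hrange _ _ hc.1 hc.2]
    exact (abs_idK_le_one _ _ a b).trans (one_le_kerBound K n)

/-- [folklore] **DECAY AT EVERY RATE** (generic): under the same hypotheses, `Decays K (kerBound K n · e^{δ·2(d+1)n}) δ` for every `δ ≥ 0`. -/
theorem decays_of_blockShift_of_range {K : MKer (d + 1) (Fib d)} {n : ℕ} (hn : 0 < n)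
    (hshift : ∀ (x y v : Site (d + 1)) (a b : Fib d), K (x + (n : ℤ) • v) (y + (n : ℤ) • v) a b = K x y a b)
    (hrange : ∀ (x y : Site (d + 1)), blk n y ≠ blk n x → (∀ α : Fin (d + 1), blk n y ≠ blk n (x + unitVec α)) → ∀ a b, K x y a b = idK x y a b)
    {δ : ℝ} (hδ : 0 ≤ δ) : Decays K (kerBound K n * Real.exp (δ * (2 * (((d : ℝ) + 1) * n)))) δ := by
  intro x y a b
  have hn1 : 1 ≤ n := hn
  have hM := one_le_kerBound K n
  set z := blk n x with hz
  have ex : x = (x + (n : ℤ) • (-z)) + (n : ℤ) • z := by rw [smul_neg]; abel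
  have ey : y = (y + (n : ℤ) • (-z)) + (n : ℤ) • z := by rw [smul_neg]; abel
  have el : l1 (x - y) = l1 ((x + (n : ℤ) • (-z)) - (y + (n : ℤ) • (-z))) := by congr 1; abel
  rw [ex, ey, hshift, ← ex, ← ey, el]
  set x₀ := x + (n : ℤ) • (-z)
  set y' := y + (n : ℤ) • (-z)
  have hx0 : blk n x₀ = 0 := by rw [blk_add_zsmul hn1, hz, add_neg_cancel]
  by_cases hc : blk n y' = blk n x₀ ∨ ∃ α : Fin (d + 1), blk n y' = blk n (x₀ + unitVec α)
  · -- inside the window: bounded entry, bounded distance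
    have hyw : blk n y' = 0 ∨ ∃ α : Fin (d + 1), blk n y' = unitVec α := by
      rcases hc with hc | ⟨α, hc⟩
      · exact Or.inl (hc.trans hx0)
      · rcases blk_add_unitVec hn x₀ α with h | h
        · exact Or.inl (hc.trans (h.trans hx0))
        · exact Or.inr ⟨α, by rw [hc, h, hx0, zero_add]⟩
    have hK : |K x₀ y' a b| ≤ kerBound K n := abs_le_kerBound_of_window K (mem_blockSitesF_of_blk_eq hn hx0) (mem_colWindow hn hyw) a b
    have hl : l1 (x₀ - y') ≤ 2 * (((d : ℝ) + 1) * n) := l1_le_of_window hn hx0 hyw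
    have he : 1 ≤ Real.exp (δ * (2 * (((d : ℝ) + 1) * n))) * Real.exp (-δ * l1 (x₀ - y')) := by
      rw [← Real.exp_add]
      exact Real.one_le_exp (by nlinarith)
    calc |K x₀ y' a b| ≤ kerBound K n * 1 := by rw [mul_one]; exact hK
      _ ≤ kerBound K n * (Real.exp (δ * (2 * (((d : ℝ) + 1) * n))) * Real.exp (-δ * l1 (x₀ - y'))) :=
          mul_le_mul_of_nonneg_left he (by linarith)
      _ = kerBound K n * Real.exp (δ * (2 * (((d : ℝ) + 1) * n))) * Real.exp (-δ * l1 (x₀ - y')) := by ring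
  · -- outside the window: the entry is `idK`
    push Not at hc
    rw [hrange _ _ hc.1 hc.2, idK_apply]
    have hpos : 0 ≤ kerBound K n * Real.exp (δ * (2 * (((d : ℝ) + 1) * n))) * Real.exp (-δ * l1 (x₀ - y')) :=
      mul_nonneg (mul_nonneg (by linarith) (Real.exp_pos _).le) (Real.exp_pos _).le
    split_ifs with h
    · rw [h.1, sub_self, abs_one]
      have h0 : l1 (0 : Site (d + 1)) = 0 := by simp [l1]
      rw [h0, mul_zero, Real.exp_zero, mul_one]
      have : 1 ≤ Real.exp (δ * (2 * (((d : ℝ) + 1) * n))) := Real.one_le_exp (by positivity)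
      nlinarith
    · rw [abs_zero]; exact hpos

/-- [folklore] **SPREAD** (generic): such a kernel is `Spr`. -/
theorem spr_of_blockShift_of_range {K : MKer (d + 1) (Fib d)} {n : ℕ} (hn : 0 < n)
    (hshift : ∀ (x y v : Site (d + 1)) (a b : Fib d), K (x + (n : ℤ) • v) (y + (n : ℤ) • v) a b = K x y a b)
    (hrange : ∀ (x y : Site (d + 1)), blk n y ≠ blk n x → (∀ α : Fin (d + 1), blk n y ≠ blk n (x + unitVec α)) → ∀ a b, K x y a b = idK x y a b) :
    Spr K :=
  ⟨_, 1, one_pos, decays_of_blockShift_of_range hn hshift hrange zero_le_one⟩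

/-! ## §3 `Ψ̂` and `Φ̂` are bounded and spread -/

section PsiPhi

variable {L : ℕ} (hL : 0 < L) {r : ℕ → (Fin (d + 1) → ℕ)} (hr : ∀ k, r k ∈ box (d + 1) L) (m : ℕ)
include hL hr

/-- [folklore] **`Ψ̂` IS BOUNDED**: `|Ψ̂_{(x,a),(y,b)}| ≤ kerBound Ψ̂ n`. -/
theorem abs_psiK_le (x y : Site (d + 1)) (a b : Fib d) : |psiK r L m x y a b| ≤ kerBound (psiK r L m) (L ^ m) :=
  abs_le_kerBound (pow_pos hL m) (fun x y v a b => psiK_shift hL r m x y v a b)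
    (fun _ _ h1 h2 a b => psiK_eq_idK_of_blk_ne hL hr m h1 h2 a b) x y a b

/-- [folklore] **`Φ̂` IS BOUNDED.** -/
theorem abs_phiK_le (x y : Site (d + 1)) (a b : Fib d) : |phiK r L m x y a b| ≤ kerBound (phiK r L m) (L ^ m) :=
  abs_le_kerBound (pow_pos hL m) (fun x y v a b => phiK_shift hL r m x y v a b)
    (fun _ _ h1 h2 a b => phiK_eq_idK_of_blk_ne hL hr m h1 h2 a b) x y a b

/-- [folklore] **`Ψ̂` DECAYS AT EVERY RATE** `δ ≥ 0` with constant `kerBound Ψ̂ n · e^{δ·2(d+1)n}`. -/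
theorem decays_psiK {δ : ℝ} (hδ : 0 ≤ δ) :
    Decays (psiK r L m) (kerBound (psiK r L m) (L ^ m) * Real.exp (δ * (2 * (((d : ℝ) + 1) * (L ^ m : ℕ))))) δ :=
  decays_of_blockShift_of_range (pow_pos hL m) (fun x y v a b => psiK_shift hL r m x y v a b)
    (fun _ _ h1 h2 a b => psiK_eq_idK_of_blk_ne hL hr m h1 h2 a b) hδ

/-- [folklore] **`Φ̂` DECAYS AT EVERY RATE.** -/
theorem decays_phiK {δ : ℝ} (hδ : 0 ≤ δ) :
    Decays (phiK r L m) (kerBound (phiK r L m) (L ^ m) * Real.exp (δ * (2 * (((d : ℝ) + 1) * (L ^ m : ℕ))))) δ :=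
  decays_of_blockShift_of_range (pow_pos hL m) (fun x y v a b => phiK_shift hL r m x y v a b)
    (fun _ _ h1 h2 a b => phiK_eq_idK_of_blk_ne hL hr m h1 h2 a b) hδ

/-- [folklore] **`Spr (psiK r L m)`** — the leaf list's `spr_psiK`. -/
theorem spr_psiK : Spr (psiK r L m) := ⟨_, 1, one_pos, decays_psiK hL hr m zero_le_one⟩

/-- [folklore] **`Spr (phiK r L m)`**. -/
theorem spr_phiK : Spr (phiK r L m) := ⟨_, 1, one_pos, decays_phiK hL hr m zero_le_one⟩

/-- [folklore] `Spr (trK (psiK r L m))`. -/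
theorem spr_trK_psiK : Spr (trK (psiK r L m)) := (spr_psiK hL hr m).trK

/-- [folklore] `Spr (trK (phiK r L m))`. -/
theorem spr_trK_phiK : Spr (trK (phiK r L m)) := (spr_phiK hL hr m).trK

end PsiPhi

end

end Summit.QuantumFields.BalabanUV.Beta.CompositeCorrectorKernel
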